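import Summits.Ventures.PercRepro.GenQBalance
import Summits.Ventures.PercRepro.PerFlatTransfer

/-!
# PercRepro — C-025 at `(q + 2, q)`: the hard max-trace rule on the rank-`q` flats at EVERY `q`, part A — the
rule and its single-point witnesses (night-4, gen 0; part B = `GenQRule.lean`)

p3's `SixFourRuleA.lean` at every `q` (mine-2's `MINE2-RLS.md` §21.0 / §23.1 (S) / §25.1 with p2's
`PerFlatTransfer.lean`): at `(p, q) = (q + 2, q)` the middle level is `Y = {S ⊆ E : ρ(S) = q + 1}`, the bottom
sets are the rank-`q` sets `B` with `ρ(E ∖ B) = q + 2`, and the rank-`q` flats `flatsQ M q` are charged through the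
HARD MAX-TRACE RULE `fHardQ` (weight `1` to a flat `P` when `S ∩ P` has rank `q` and maximal size among the traces
of `S` on the rank-`q` flats), normalised by `DHardQ S = Σ_P fHardQ P S`.  This part proves the single-witness share
bound, in `M` itself: for `S = B ∪ {x}` (`B ⊆ G` of rank `q`, `x ∈ E ∖ G`), `ρ(S) = q + 1`, the trace on `G` is `B`
and is maximal (`fHardQ_single_eq_one`), and every other rank-`q` flat of maximal trace misses exactly one point
`c ∈ B`, a coloop of `M|B` (`sdiff_eq_singleton_coloop_q`) — so `DHardQ S ≤ 1 + m(B)` (`DHardQ_single_le`) and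
the share of `G` is at least `w_∞(B) = 1/(1 + m(B))` (`share_single_ge_q`).  Part B sums the shares, bounds the
demand by the type and states the per-flat transfer and the core of the `(q + 2, q)` row.  At `q = 4` every
statement is the landed `(6, 4)` one (`fHard`, `DHard`, `share_single_ge`).  No simplicity is used.
-/
open scoped Matroid

namespace PercRepro.GenQ

open Finset ThmH PerFlat SixFour

variable {α : Type*} [DecidableEq α] {M : Matroid α} [M.Finite]

/-! ## Rank-`q` flats -/

omit [DecidableEq α] in
/-- `q + 1 ≤ q` is false in `ℕ∞`. -/
theorem not_succ_le_self_enat (q : ℕ) : ¬ ((q : ℕ∞) + 1 ≤ (q : ℕ∞)) := by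
  intro h
  have h' : ((q + 1 : ℕ) : ℕ∞) ≤ (q : ℕ∞) := by
    push_cast
    exact h
  have := (Nat.cast_le (α := ℕ∞)).1 h'
  omega

omit [DecidableEq α] in
/-- A rank-`q` subset of a rank-`q` flat has the flat as its closure. -/
theorem closure_eq_of_subset_flatQ {G B : Finset α} {q : ℕ} (hG : G ∈ flatsQ M q) (hB : B ⊆ G)
    (hr : M.eRk (B : Set α) = (q : ℕ∞)) : M.closure (B : Set α) = (G : Set α) := by
  obtain ⟨-, hGflat, hGr⟩ := mem_flatsQ.1 hG
  exact closure_eq_of_subset_flat hGflat (Finset.coe_subset.2 hB) B.finite_toSet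
    (by rw [hGr, hr])

omit [DecidableEq α] in
/-- Two rank-`q` flats sharing a rank-`q` subset coincide. -/
theorem flatsQ_eq_of_subset {G G' B : Finset α} {q : ℕ} (hG : G ∈ flatsQ M q) (hG' : G' ∈ flatsQ M q)
    (hB : B ⊆ G) (hB' : B ⊆ G') (hr : M.eRk (B : Set α) = (q : ℕ∞)) : G = G' :=
  Finset.coe_injective
    ((closure_eq_of_subset_flatQ hG hB hr).symm.trans (closure_eq_of_subset_flatQ hG' hB' hr))

omit [DecidableEq α] in
/-- Membership in `Yq M (q + 2) q`: subsets of the ground set of rank `q + 1`. -/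
theorem mem_Yq_succ_succ {S : Finset α} {q : ℕ} :
    S ∈ Yq M (q + 2) q ↔ S ⊆ gr M ∧ (q : ℕ∞) < M.eRk (S : Set α) ∧ M.eRk (S : Set α) < ((q + 2 : ℕ) : ℕ∞) := by
  unfold Yq
  rw [Finset.mem_filter, Finset.mem_powerset]

/-- Membership in `UqG M (q + 2) q G`. -/
theorem mem_UqG_succ_succ {G B : Finset α} {q : ℕ} :
    B ∈ UqG M (q + 2) q G ↔
      (B ⊆ gr M ∧ M.eRk (B : Set α) = (q : ℕ∞) ∧
        M.eRk ((gr M \ B : Finset α) : Set α) = ((q + 2 : ℕ) : ℕ∞)) ∧ B ⊆ G := by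
  unfold UqG
  rw [Finset.mem_filter, mem_Uq]

/-! ## The hard max-trace rule at level `q` -/

/-- The hard max-trace rule at level `q`: a rank-`q` flat `P` receives weight `1` from `S` when the trace `S ∩ P`
has rank `q` and is of maximal size among the traces of `S` on the rank-`q` flats, and `0` otherwise. -/
noncomputable def fHardQ (M : Matroid α) [M.Finite] (q : ℕ) (P S : Finset α) : ℚ :=
  if M.eRk ((S ∩ P : Finset α) : Set α) = (q : ℕ∞) ∧ ∀ P' ∈ flatsQ M q, (S ∩ P').card ≤ (S ∩ P).card then 1
  else 0

/-- The rule is nonnegative. -/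
theorem fHardQ_nonneg (q : ℕ) (P S : Finset α) : 0 ≤ fHardQ M q P S := by
  unfold fHardQ
  split_ifs <;> norm_num

/-- The denominator `DHardQ S = Σ_{P ∈ flatsQ M q} fHardQ P S`. -/
noncomputable def DHardQ (M : Matroid α) [M.Finite] (q : ℕ) (S : Finset α) : ℚ :=
  ∑ P ∈ flatsQ M q, fHardQ M q P S

/-- The denominator is nonnegative. -/
theorem DHardQ_nonneg (q : ℕ) (S : Finset α) : 0 ≤ DHardQ M q S :=
  Finset.sum_nonneg (fun P _ => fHardQ_nonneg q P S)

/-! ## The single-point witnesses `S = B ∪ {x}` -/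

section Single

variable {G B : Finset α} {x : α} {q : ℕ}

omit [M.Finite] in
/-- `(B ∪ {x}) ∩ G = B` for `B ⊆ G`, `x ∉ G`. -/
theorem insert_inter_eq_q (hB : B ⊆ G) (hxG : x ∉ G) : (insert x B) ∩ G = B := by
  ext y
  rw [Finset.mem_inter, Finset.mem_insert]
  constructor
  · rintro ⟨rfl | hyB, hyG⟩
    · exact absurd hyG hxG
    · exact hyB
  · intro hyB
    exact ⟨Or.inr hyB, hB hyB⟩

/-- The witness `B ∪ {x}` has rank `q + 1`. -/
theorem eRk_insert_eq_succ_q (hG : G ∈ flatsQ M q) (hB : B ⊆ G) (hr : M.eRk (B : Set α) = (q : ℕ∞))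
    (hx : x ∈ gr M) (hxG : x ∉ G) : M.eRk ((insert x B : Finset α) : Set α) = (q : ℕ∞) + 1 := by
  have hxcl : x ∈ M.E \ M.closure (B : Set α) := by
    rw [closure_eq_of_subset_flatQ hG hB hr, ← coe_gr]
    exact ⟨hx, hxG⟩
  rw [Finset.coe_insert, Matroid.eRk_insert_eq_add_one hxcl, hr]

/-- No rank-`q` flat contains the witness `B ∪ {x}`. -/
theorem not_subset_of_witness (hG : G ∈ flatsQ M q) (hB : B ⊆ G) (hr : M.eRk (B : Set α) = (q : ℕ∞))
    (hx : x ∈ gr M) (hxG : x ∉ G) {P : Finset α} (hP : P ∈ flatsQ M q) : ¬ insert x B ⊆ P := by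
  intro hsub
  have hle : M.eRk ((insert x B : Finset α) : Set α) ≤ M.eRk (P : Set α) :=
    M.eRk_mono (Finset.coe_subset.2 hsub)
  rw [eRk_insert_eq_succ_q hG hB hr hx hxG, (mem_flatsQ.1 hP).2.2] at hle
  exact not_succ_le_self_enat q hle

/-- The flat `G` gets the full weight from its single-point witness `B ∪ {x}`: the trace is `B` itself, of
rank `q`, and no rank-`q` flat contains all of `B ∪ {x}` (which has rank `q + 1`). -/
theorem fHardQ_single_eq_one (hG : G ∈ flatsQ M q) (hB : B ⊆ G) (hr : M.eRk (B : Set α) = (q : ℕ∞))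
    (hx : x ∈ gr M) (hxG : x ∉ G) : fHardQ M q G (insert x B) = 1 := by
  have hSG := insert_inter_eq_q hB hxG
  unfold fHardQ
  rw [if_pos]
  refine ⟨by rw [hSG, hr], ?_⟩
  intro P' hP'
  rw [hSG]
  by_contra hlt
  push Not at hlt
  have hsub : (insert x B) ∩ P' ⊆ insert x B := Finset.inter_subset_left
  have hcard : (insert x B).card ≤ ((insert x B) ∩ P').card := by
    have := Finset.card_insert_le x B
    omega
  have heq : (insert x B) ∩ P' = insert x B := Finset.eq_of_subset_of_card_le hsub hcard
  have hsubP : insert x B ⊆ P' := by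
    rw [← heq]
    exact Finset.inter_subset_right
  exact not_subset_of_witness hG hB hr hx hxG hP' hsubP

/-- A rank-`q` flat `P ≠ G` of maximal trace on the witness `S = B ∪ {x}` misses exactly one point `c` of `B`,
and `c` is a coloop of `M|B`: `S ∖ P = {c}` with `c ∈ coloopsOf M B`. -/
theorem sdiff_eq_singleton_coloop_q (hG : G ∈ flatsQ M q) (hB : B ⊆ G) (hr : M.eRk (B : Set α) = (q : ℕ∞))
    (hx : x ∈ gr M) (hxG : x ∉ G) {P : Finset α} (hP : P ∈ flatsQ M q) (hne : P ≠ G)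
    (hrP : M.eRk (((insert x B) ∩ P : Finset α) : Set α) = (q : ℕ∞))
    (hmax : ∀ P' ∈ flatsQ M q, ((insert x B) ∩ P').card ≤ ((insert x B) ∩ P).card) :
    ∃ c ∈ coloopsOf M B, (insert x B) \ P = {c} := by
  have hSG := insert_inter_eq_q hB hxG
  have hq1 := eRk_insert_eq_succ_q hG hB hr hx hxG
  have hxB : x ∉ B := fun h => hxG (hB h)
  have hcardS : (insert x B).card = B.card + 1 := Finset.card_insert_of_notMem hxB
  -- `|S ∩ P| ≥ |S ∩ G| = |B|`
  have hge : B.card ≤ ((insert x B) ∩ P).card := by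
    have := hmax G hG
    rwa [hSG] at this
  -- `|S ∩ P| ≤ |B|` (otherwise `S ⊆ P`, of rank `q`)
  have hle : ((insert x B) ∩ P).card ≤ B.card := by
    by_contra hlt
    push Not at hlt
    have hsub : (insert x B) ∩ P ⊆ insert x B := Finset.inter_subset_left
    have heq : (insert x B) ∩ P = insert x B := Finset.eq_of_subset_of_card_le hsub (by omega)
    have hsubP : insert x B ⊆ P := by
      rw [← heq]
      exact Finset.inter_subset_right
    exact not_subset_of_witness hG hB hr hx hxG hP hsubP
  have hcard1 : ((insert x B) \ P).card = 1 := by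
    rw [Finset.card_sdiff, Finset.inter_comm]
    omega
  obtain ⟨c, hc⟩ := Finset.card_eq_one.1 hcard1
  refine ⟨c, ?_, hc⟩
  have hcmem : c ∈ (insert x B) \ P := by
    rw [hc]
    exact Finset.mem_singleton_self c
  have hcS : c ∈ insert x B := (Finset.mem_sdiff.1 hcmem).1
  -- `S ∩ P = S ∖ {c}`
  have hSP : (insert x B) ∩ P = (insert x B).erase c := by
    rw [← Finset.sdiff_sdiff_self_left, hc, Finset.sdiff_singleton_eq_erase]
  -- `c ≠ x`: otherwise `B ⊆ P` and `P = G`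
  have hcx : c ≠ x := by
    rintro rfl
    have hBP : B ⊆ P := by
      have : (insert c B) ∩ P = B := by rw [hSP, Finset.erase_insert hxB]
      rw [← this]
      exact Finset.inter_subset_right
    exact hne (flatsQ_eq_of_subset hP hG hBP hB hr)
  have hcB : c ∈ B := by
    rcases Finset.mem_insert.1 hcS with h | h
    · exact absurd h hcx
    · exact h
  -- `c ∉ cl(S ∖ {c})`, since `ρ(S ∖ {c}) = q < q + 1 = ρ(S)`
  have hrSc : M.eRk (((insert x B).erase c : Finset α) : Set α) = (q : ℕ∞) := by
    rw [← hSP]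
    exact hrP
  have hccl : c ∉ M.closure (((insert x B).erase c : Finset α) : Set α) := by
    intro hmem
    have h1 : M.eRk ((insert c ((insert x B).erase c) : Finset α) : Set α) =
        M.eRk (((insert x B).erase c : Finset α) : Set α) := by
      rw [Finset.coe_insert, ← M.eRk_closure_eq (insert c _),
        Matroid.closure_insert_eq_of_mem_closure hmem, M.eRk_closure_eq]
    rw [Finset.insert_erase hcS, hq1, hrSc] at h1
    exact not_succ_le_self_enat q h1.le
  -- hence `c ∉ cl(B ∖ {c})`: `c` is a coloop of `M|B`
  rw [mem_coloopsOf]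
  refine ⟨hcB, fun hmem => hccl ?_⟩
  exact M.closure_subset_closure
    (Finset.coe_subset.2 (Finset.erase_subset_erase c (Finset.subset_insert x B))) hmem

/-- The rank-`q` flats of maximal trace on `S = B ∪ {x}` other than `G` number at most `m(B)`: `P ↦ S ∖ P`
injects them into the singletons of coloops of `M|B`. -/
theorem card_maxFlats_le_q (hG : G ∈ flatsQ M q) (hB : B ⊆ G) (hr : M.eRk (B : Set α) = (q : ℕ∞))
    (hx : x ∈ gr M) (hxG : x ∉ G) :
    (((flatsQ M q).erase G).filter (fun P => M.eRk (((insert x B) ∩ P : Finset α) : Set α) = (q : ℕ∞) ∧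
      ∀ P' ∈ flatsQ M q, ((insert x B) ∩ P').card ≤ ((insert x B) ∩ P).card)).card ≤ mTr M B := by
  unfold mTr
  refine le_trans (Finset.card_le_card_of_injOn (fun P => (insert x B) \ P) ?_ ?_)
    (Finset.card_image_le (f := fun c => ({c} : Finset α)))
  · intro P hP
    rw [Finset.mem_coe, Finset.mem_filter, Finset.mem_erase] at hP
    obtain ⟨⟨hne, hPf⟩, hrP, hmax⟩ := hP
    obtain ⟨c, hc, hSP⟩ := sdiff_eq_singleton_coloop_q hG hB hr hx hxG hPf hne hrP hmax
    rw [Finset.mem_coe, Finset.mem_image]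
    exact ⟨c, hc, hSP.symm⟩
  · intro P hP P' hP' hPP'
    rw [Finset.mem_coe, Finset.mem_filter, Finset.mem_erase] at hP hP'
    obtain ⟨⟨-, hPf⟩, hrP, -⟩ := hP
    obtain ⟨⟨-, hPf'⟩, -, -⟩ := hP'
    simp only at hPP'
    have hinter : (insert x B) ∩ P = (insert x B) ∩ P' := by
      rw [← Finset.sdiff_sdiff_self_left, hPP', Finset.sdiff_sdiff_self_left]
    have hsub : (insert x B) ∩ P ⊆ P := Finset.inter_subset_right
    have hsub' : (insert x B) ∩ P ⊆ P' := by
      rw [hinter]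
      exact Finset.inter_subset_right
    exact flatsQ_eq_of_subset hPf hPf' hsub hsub' hrP

/-- **The denominator of a single-point witness**: `DHardQ (B ∪ {x}) ≤ 1 + m(B)`. -/
theorem DHardQ_single_le (hG : G ∈ flatsQ M q) (hB : B ⊆ G) (hr : M.eRk (B : Set α) = (q : ℕ∞))
    (hx : x ∈ gr M) (hxG : x ∉ G) : DHardQ M q (insert x B) ≤ 1 + (mTr M B : ℚ) := by
  unfold DHardQ
  rw [← Finset.add_sum_erase (flatsQ M q) _ hG, fHardQ_single_eq_one hG hB hr hx hxG]
  apply add_le_add (le_refl _)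
  unfold fHardQ
  rw [Finset.sum_boole]
  exact_mod_cast card_maxFlats_le_q hG hB hr hx hxG

/-- The denominator of a single-point witness is positive (`G` itself contributes `1`). -/
theorem DHardQ_single_pos (hG : G ∈ flatsQ M q) (hB : B ⊆ G) (hr : M.eRk (B : Set α) = (q : ℕ∞))
    (hx : x ∈ gr M) (hxG : x ∉ G) : 0 < DHardQ M q (insert x B) := by
  unfold DHardQ
  have h1 : fHardQ M q G (insert x B) ≤ ∑ P ∈ flatsQ M q, fHardQ M q P (insert x B) :=
    Finset.single_le_sum (fun P _ => fHardQ_nonneg q P _) hG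
  rw [fHardQ_single_eq_one hG hB hr hx hxG] at h1
  linarith

/-- **The single-witness share**: `G` receives at least `w_∞(B) = 1/(1 + m(B))` from `B ∪ {x}`. -/
theorem share_single_ge_q (hG : G ∈ flatsQ M q) (hB : B ⊆ G) (hr : M.eRk (B : Set α) = (q : ℕ∞))
    (hx : x ∈ gr M) (hxG : x ∉ G) :
    wInf M B ≤ fHardQ M q G (insert x B) / DHardQ M q (insert x B) := by
  rw [fHardQ_single_eq_one hG hB hr hx hxG]
  unfold wInf
  exact one_div_le_one_div_of_le (DHardQ_single_pos hG hB hr hx hxG) (DHardQ_single_le hG hB hr hx hxG)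

end Single

end PercRepro.GenQ
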